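import Summits.ResolutionOfSingularities.ResolutionOfSingularities.Theorems.FrobeniusLadderFRationalResolutionMonoidAlgebraChart
import Summits.ResolutionOfSingularities.ResolutionOfSingularities.Theorems.FrobeniusLadderFRationalResolutionMonoidAlgebraModel
import Summits.ResolutionOfSingularities.ResolutionOfSingularities.Theorems.FrobeniusLadderFRationalResolutionMonoidAlgebraVertexGenerators
import Summits.ResolutionOfSingularities.ResolutionOfSingularities.Theorems.FrobeniusLadderFRationalResolutionLocalToricModelBlowupAtPrime
import HarnessLib

/-!
# Crux `FrobeniusLadder.FRationalResolution` (stmt-ResolutionOfSingularities-15317), line `redirect`,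
# stub `stub_diagonalizableQuotientResolution` — THE PER-CHART CERTIFICATE FROM CONE DATA (step 3 of (β-chart),
# MEMO-15317-leafhand2-g25 §3): on a chart `C = κ[P][J/χ^{e₀}] ≅ κ[Q]` the certificate of `…MonoidAlgebraModel.hasResolution_of_isolated_fixedPoints_of_monoidAlgebra_certificate`
# follows from: the faces of the chart cone are regular (`κ[Q][1/χ^g]` regular for the generators `g`) and — if the vertex is singular — a
# vertex certificate for `Q` over every field

With `…MonoidAlgebraChart.exists_algHom_chart` (p843549: `Φ : κ[Q] ≅ C` inside `κ[P][1/χ^{e₀}]`), the model facts for `κ[Q]`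
(`…MonoidAlgebraModel`, p843485; `…MonoidAlgebraVertexGenerators`, p843511) transport to the chart ring `C`: the vertex `𝔪 = Φ(𝔳_Q)` is
a maximal ideal generated by the `Φ(χᵍ)` (`g ∈ G_Q`), `C[1/Φ(χᵍ)] ≅ κ[Q][1/χᵍ]`, `C` carries d = 0 chart data at `𝔪` by `Q` with
`dim C_𝔪 = rank Q`, so `…LocalToricModelBlowupAtPrime.isRegular_affineBlowup_atPrime_of_chartData` (p843354) gives the point blow-up at `𝔪`
from a vertex certificate for the monomial algebra of `G_Q` (over the residue field of `C_𝔪`; supplied for every field).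

* ★★★ `chartCertificate_of_cone` — the per-chart certificate `∃ G' 𝔪 M, …` for `C = blowupAlgebra J (χ^{e₀})` from cone data.

Honest label: assembly toward ONE leaf stub (no stub, crux or summit closed). No definitions, no named facts, no sorry.
[folklore; cite: CoxLittleSchenck2011, §1.1, §3.3; Kollar2007, §2.2] [cite: Kato1994, Thm. (3.2)] [cite: Matsumura1987, Thm. 19.3; §32]
-/

noncomputable section

-- single-problem summit: the doubled namespace component is forced
set_option linter.dupNamespace false

open AlgebraicGeometry IsLocalRing
open Literature.RingTheory.MvPowerSeries Literature.RingTheory.MvPowerSeries.monoidPowerSeries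
open Literature.AlgebraicGeometry.Resolution

namespace Summit.ResolutionOfSingularities.ResolutionOfSingularities.Theorems.FRationalResolution.MonoidAlgebraLaurent

variable (κ : Type) [Field κ] {n : ℕ} (P : AddSubmonoid (Fin n →₀ ℕ))

/-- The exponent of `p ∈ ℕⁿ` in `ℤⁿ`. -/
local notation3 (prettyPrint := false) "toZ" =>
  (Finsupp.mapRange.addMonoidHom (Nat.castAddMonoidHom ℤ) : (Fin n →₀ ℕ) →+ (Fin n →₀ ℤ))

/-- The vertex ideal `𝔳_Q = (χ^q : 0 ≠ q ∈ Q)` of a monoid algebra `κ[Q]`. -/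
local notation3 (prettyPrint := false) "𝕍[" κ ", " Q "]" =>
  Ideal.span ((fun p : ↥Q => AddMonoidAlgebra.single p (1 : κ)) '' {p : ↥Q | p ≠ 0})

/-- Regularity of `A[1/x]` transports along a ring isomorphism `e : A ≃+* B` to `B[1/e x]`. [folklore] -/
theorem isRegularRing_away_of_ringEquiv {A B : Type} [CommRing A] [CommRing B] (e : A ≃+* B) (x : A)
    [h : IsRegularRing (Localization.Away x)] : IsRegularRing (Localization.Away (e x)) := by
  have H : (Submonoid.powers x).map e.toMonoidHom = Submonoid.powers (e x) := Submonoid.map_powers _ _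
  exact IsRegularRing.of_ringEquiv
    (IsLocalization.ringEquivOfRingEquiv (Localization.Away x) (Localization.Away (e x)) e H)

/-- ★★★ **THE PER-CHART CERTIFICATE FROM CONE DATA.** `P ⊆ ℕⁿ`, `E ⊆ P`, `e₀ ∈ P`, `J = (χᵉ : e ∈ E)`, `C = κ[P][J/χ^{e₀}]`; cone data
`(Q, ι)` as in `exists_algHom_chart`, a finite `G_Q ∌ 0` generating `Q` with `κ[Q][1/χᵍ]` regular for `g ∈ G_Q` (the proper faces of the
chart cone are regular), and a vertex certificate for the monomial algebra of `G_Q` over every field (needed only if `C_𝔪` is singular;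
e.g. `veroneseCone_isRegular_affineBlowup`). Then `C` carries the per-chart certificate of the monoid-algebra consumer, for ANY ideal `𝔞`
in the slot `𝔪^M ⊆ 𝔞 + (G')`. [folklore; cite: CoxLittleSchenck2011, §3.3] [cite: Kato1994, Thm. (3.2)] -/
theorem chartCertificate_of_cone (e₀ : ↥P) (E : Set ↥P)
    {n' : ℕ} (Q : AddSubmonoid (Fin n' →₀ ℕ)) (ι : ↥Q →+ (Fin n →₀ ℤ)) (hι : Function.Injective ι)
    (hE : ∀ e ∈ E, ∃ q : ↥Q, ι q = toZ (e : Fin n →₀ ℕ) - toZ (e₀ : Fin n →₀ ℕ))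
    (hP : ∀ p : ↥P, ∃ q : ↥Q, ι q = toZ (p : Fin n →₀ ℕ))
    (hQ : ∀ q : ↥Q, ∃ (p : ↥P) (m : ℕ) (e : Fin m → ↥P), (∀ i, e i ∈ E) ∧
      ι q = toZ (p : Fin n →₀ ℕ) + ∑ i, (toZ ((e i : ↥P) : Fin n →₀ ℕ) - toZ (e₀ : Fin n →₀ ℕ)))
    (GQ : Set (Fin n' →₀ ℕ)) (hGQfin : GQ.Finite) (hGQ0 : (0 : Fin n' →₀ ℕ) ∉ GQ) (hGQ : AddSubmonoid.closure GQ = Q)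
    (hface : ∀ q : ↥Q, (q : Fin n' →₀ ℕ) ∈ GQ → IsRegularRing (Localization.Away (AddMonoidAlgebra.single q (1 : κ))))
    (hvert : ∀ (K : Type) [Field K], Scheme.IsRegular (affineBlowup (Ideal.span {v : ↥(Algebra.adjoin K
        ((fun d : Fin n' →₀ ℕ => MvPolynomial.monomial d (1 : K)) '' GQ)) |
        ∃ d ∈ GQ, (v : MvPolynomial (Fin n') K) = MvPolynomial.monomial d 1})))
    (𝔞 : Ideal (blowupAlgebra (Ideal.span ((fun e : ↥P => AddMonoidAlgebra.single e (1 : κ)) '' E))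
      (AddMonoidAlgebra.single e₀ (1 : κ)))) :
    ∃ (G' : Set (blowupAlgebra (Ideal.span ((fun e : ↥P => AddMonoidAlgebra.single e (1 : κ)) '' E))
          (AddMonoidAlgebra.single e₀ (1 : κ))))
      (𝔪 : Ideal (blowupAlgebra (Ideal.span ((fun e : ↥P => AddMonoidAlgebra.single e (1 : κ)) '' E))
          (AddMonoidAlgebra.single e₀ (1 : κ)))) (_ : 𝔪.IsMaximal) (M : ℕ),
      (∀ g ∈ G', IsRegularRing (Localization.Away g)) ∧ 𝔪 ^ M ≤ 𝔞 ⊔ Ideal.span G' ∧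
      (¬ IsRegularLocalRing (Localization.AtPrime 𝔪) →
        Scheme.IsRegular (affineBlowup (R := Localization.AtPrime 𝔪) (maximalIdeal (Localization.AtPrime 𝔪)))) := by
  classical
  -- the chart ring as the monoid algebra of `Q`
  obtain ⟨Φ, hΦinj, hΦrange, -⟩ := exists_algHom_chart κ P e₀ E Q ι hι hE hP hQ
  have hΦmem : ∀ x, Φ x ∈ blowupAlgebra (Ideal.span ((fun e : ↥P => AddMonoidAlgebra.single e (1 : κ)) '' E)) (AddMonoidAlgebra.single e₀ (1 : κ)) := fun x => by
    have : Φ x ∈ Set.range Φ := ⟨x, rfl⟩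
    rw [hΦrange] at this
    exact this
  let f : AddMonoidAlgebra κ ↥Q →+* ↥(blowupAlgebra (Ideal.span ((fun e : ↥P => AddMonoidAlgebra.single e (1 : κ)) '' E)) (AddMonoidAlgebra.single e₀ (1 : κ))) := Φ.toRingHom.codRestrict (blowupAlgebra (Ideal.span ((fun e : ↥P => AddMonoidAlgebra.single e (1 : κ)) '' E)) (AddMonoidAlgebra.single e₀ (1 : κ))) hΦmem
  have hf : ∀ x, ((f x : ↥(blowupAlgebra (Ideal.span ((fun e : ↥P => AddMonoidAlgebra.single e (1 : κ)) '' E)) (AddMonoidAlgebra.single e₀ (1 : κ)))) : Localization.Away (AddMonoidAlgebra.single e₀ (1 : κ))) = Φ x := fun _ => rfl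
  have hfbij : Function.Bijective f := by
    constructor
    · intro a b hab
      exact hΦinj (by rw [← hf, ← hf, hab])
    · intro z
      have hz : (z : Localization.Away (AddMonoidAlgebra.single e₀ (1 : κ))) ∈ Set.range Φ := by rw [hΦrange]; exact z.2
      obtain ⟨x, hx⟩ := hz
      exact ⟨x, Subtype.ext (by rw [hf, hx])⟩
  let e : AddMonoidAlgebra κ ↥Q ≃+* ↥(blowupAlgebra (Ideal.span ((fun e : ↥P => AddMonoidAlgebra.single e (1 : κ)) '' E)) (AddMonoidAlgebra.single e₀ (1 : κ))) := RingEquiv.ofBijective f hfbij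
  have he : ∀ x, e x = f x := fun _ => rfl
  -- model facts for `κ[Q]`
  have hQfg : Q.FG := ⟨hGQfin.toFinset, by rw [Set.Finite.coe_toFinset, hGQ]⟩
  haveI h𝔳Q := MonoidAlgebraModel.vertexIdeal_isMaximal κ Q GQ hGQ0 hGQ
  haveI := MonoidAlgebraModel.finiteType κ Q hQfg
  haveI : IsNoetherianRing (AddMonoidAlgebra κ ↥Q) := Algebra.FiniteType.isNoetherianRing κ _
  haveI : IsNoetherianRing ↥(blowupAlgebra (Ideal.span ((fun e : ↥P => AddMonoidAlgebra.single e (1 : κ)) '' E)) (AddMonoidAlgebra.single e₀ (1 : κ))) := isNoetherianRing_of_ringEquiv _ e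
  obtain ⟨χ, hχ, hχ0, hχadd, hχm, hgen⟩ := MonoidAlgebraModel.chart κ Q
  -- the vertex of the chart
  set 𝔪 : Ideal ↥(blowupAlgebra (Ideal.span ((fun e : ↥P => AddMonoidAlgebra.single e (1 : κ)) '' E)) (AddMonoidAlgebra.single e₀ (1 : κ))) := (𝕍[κ, Q]).comap e.symm.toRingHom with h𝔪
  have hmem𝔪 : ∀ s, s ∈ 𝕍[κ, Q] ↔ e s ∈ 𝔪 := fun s => by
    rw [h𝔪, Ideal.mem_comap]
    change _ ↔ e.symm (e s) ∈ _
    rw [RingEquiv.symm_apply_apply]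
  haveI h𝔪max : 𝔪.IsMaximal := Ideal.comap_isMaximal_of_surjective _ e.symm.surjective
  have h𝔪map : 𝔪 = (𝕍[κ, Q]).map e.toRingHom := by
    rw [h𝔪]
    exact Ideal.comap_symm e
  -- the generators of the vertex: images of the `χᵍ`, `g ∈ G_Q`
  refine ⟨(fun q : ↥Q => e (AddMonoidAlgebra.single q 1)) '' {q : ↥Q | (q : Fin n' →₀ ℕ) ∈ GQ}, 𝔪, h𝔪max, 1, ?_, ?_, ?_⟩
  · -- faces: `C[1/e(χᵍ)] ≅ κ[Q][1/χᵍ]` is regular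
    rintro _ ⟨q, hq, rfl⟩
    haveI := hface q hq
    exact isRegularRing_away_of_ringEquiv e (AddMonoidAlgebra.single q (1 : κ))
  · -- `𝔪 = (e(χᵍ) : g ∈ G_Q)`
    rw [pow_one, h𝔪map, MonoidAlgebraModel.vertexIdeal_eq_span_image κ Q GQ hGQ0 hGQ, Ideal.map_span, ← Set.image_comp]
    exact le_sup_of_le_right (le_of_eq rfl)
  · -- the point blow-up at the vertex, from chart data by `Q` and the vertex certificate
    intro _
    have hdim : ringKrullDim (Localization.AtPrime 𝔪) = rank Q := by
      obtain ⟨g⟩ := CompletedBaseChangeFibrePoints.nonempty_ringEquiv_localization_of_ringEquiv e (𝕍[κ, Q]) 𝔪 hmem𝔪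
      rw [← ringKrullDim_eq_of_ringEquiv g]
      exact MonoidAlgebraModel.ringKrullDim_localization_vertexIdeal_eq_rank κ Q GQ hGQfin hGQ0 hGQ
    refine LocalToricModelBlowup.isRegular_affineBlowup_atPrime_of_chartData 𝔪
      ((algebraMap (AddMonoidAlgebra κ ↥P) ↥(blowupAlgebra (Ideal.span ((fun e : ↥P => AddMonoidAlgebra.single e (1 : κ)) '' E)) (AddMonoidAlgebra.single e₀ (1 : κ)))).comp (algebraMap κ (AddMonoidAlgebra κ ↥P)))
      GQ hGQfin hGQ0 Q hGQ (fun p => e (χ p)) (by rw [hχ0, map_one]) (fun a ha b hb => by rw [hχadd a ha b hb, map_mul])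
      (fun p hp hp0 => (hmem𝔪 _).mp (hχm p hp hp0)) ?_ hdim (hvert _)
    rw [h𝔪map]
    refine (Ideal.map_mono hgen).trans ?_
    rw [Ideal.map_span, ← Set.image_comp]
    exact le_of_eq rfl

end Summit.ResolutionOfSingularities.ResolutionOfSingularities.Theorems.FRationalResolution.MonoidAlgebraLaurent

end
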